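import Literature.AlgebraicGeometry.Frobenioids.Frobenioid
import HarnessLib

/-!
# Frobenioids I, Definition 1.2 (ii) / 1.3 (i)(c): formal facts about pull-back morphisms of a
# pre-Frobenioid (STEP-0 calibration fragment of the abc-iut cell)

Mochizuki, *The geometry of Frobenioids I: the general theory*, Kyushu J. Math. **62** (2008)
293–400, §1, Definitions 1.2 (ii), 1.3 (i)(c), kurims text pp. 22–24 [cite: MochizukiFrdI2008, Def. 1.2(ii)].

Three formal consequences of the definition of a pull-back morphism (the natural transformation
`Hom(−, A) → Hom(−, B) ×_{Hom(−, B_D)} Hom(−, A_D)` is an isomorphism), valid in an arbitrary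
pre-Frobenioid and used by the Frobenioid verifications (`F_Φ`, Prop. 1.5; fiber products,
Prop. 1.6; model Frobenioids, Thm. 5.2): two-out-of-three, and faithfulness / fullness of
`C^pl-bk_A → D_{A_D}` (two of the three clauses of Def. 1.3 (i)(c)). Also the pull-back `f^*` along
an isomorphism `f` of `D` as a multiplicative equivalence. No statement of the paper is strengthened.
-/

namespace Literature.AlgebraicGeometry.Frobenioids

open CategoryTheory Opposite

universe w v v' u u'

/-! ### Two formal facts about pull-back morphisms in an arbitrary pre-Frobenioid -/

namespace PreFrobenioid

variable {D : Type u} [Category.{v} D] {Φ : Dᵒᵖ ⥤ CommMonCat.{w}}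
  {C : Type u'} [Category.{v'} C] (F : C ⥤ ElemFrobenioid Φ)

/-- Two-out-of-three for pull-back morphisms: if `ψ` and `γ ≫ ψ` are pull-back morphisms, so is
`γ` (formal from FrdI Def. 1.2 (ii)). [cite: MochizukiFrdI2008, Def. 1.2(ii)] -/
theorem IsPullbackMorphism.of_comp {X Y Z : C} {γ : X ⟶ Y} {ψ : Y ⟶ Z}
    (hψ : IsPullbackMorphism F ψ) (hγψ : IsPullbackMorphism F (γ ≫ ψ)) :
    IsPullbackMorphism F γ := by
  intro W
  constructor
  · intro g g' h
    have h1 : g ≫ γ = g' ≫ γ := congrArg (fun p : PullbackHomData F γ W => p.1.1) h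
    have h2 : Base F g = Base F g' := congrArg (fun p : PullbackHomData F γ W => p.1.2) h
    apply (hγψ W).1
    apply Subtype.ext
    apply Prod.ext
    · show g ≫ γ ≫ ψ = g' ≫ γ ≫ ψ
      rw [← Category.assoc, h1, Category.assoc]
    · exact h2
  · rintro ⟨⟨δ, ε⟩, hδ⟩
    dsimp only at hδ
    obtain ⟨g, hg⟩ := (hγψ W).2 ⟨(δ ≫ ψ, ε), by rw [base_comp, hδ, base_comp, Category.assoc]⟩
    have hg1 : g ≫ γ ≫ ψ = δ ≫ ψ := congrArg (fun p : PullbackHomData F (γ ≫ ψ) W => p.1.1) hg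
    have hg2 : Base F g = ε := congrArg (fun p : PullbackHomData F (γ ≫ ψ) W => p.1.2) hg
    have hgγ : g ≫ γ = δ := by
      apply (hψ W).1
      apply Subtype.ext
      apply Prod.ext
      · show (g ≫ γ) ≫ ψ = δ ≫ ψ
        rw [Category.assoc, hg1]
      · show Base F (g ≫ γ) = Base F δ
        rw [base_comp, hg2, hδ]
    exact ⟨g, Subtype.ext (Prod.ext hgγ hg2)⟩

/-- `C^pl-bk_A → D_{A_D}` is faithful in any pre-Frobenioid (formal from the injectivity half of
the definition of a pull-back morphism, FrdI Def. 1.2 (ii), 1.3 (i)(c)). [cite: MochizukiFrdI2008, Def. 1.3(i)] -/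
theorem pullbackSliceToBase_faithful (A : C) : (pullbackSliceToBase F A).Faithful := by
  refine ⟨fun {Y Y'} {f g} h => ?_⟩
  have hb : Base F f.left.1 = Base F g.left.1 := congrArg CommaMorphism.left h
  have hf : f.left.1 ≫ Y'.hom.1 = Y.hom.1 := congrArg InducedWideCategory.Hom.hom (Over.w f)
  have hg : g.left.1 ≫ Y'.hom.1 = Y.hom.1 := congrArg InducedWideCategory.Hom.hom (Over.w g)
  have key : f.left.1 = g.left.1 := by
    apply (Y'.hom.2 Y.left.obj).1
    exact Subtype.ext (Prod.ext (hf.trans hg.symm) hb)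
  exact Over.OverMorphism.ext (InducedWideCategory.Hom.ext key)

/-- `C^pl-bk_A → D_{A_D}` is full in any pre-Frobenioid (formal from the surjectivity half of the
definition of a pull-back morphism and two-out-of-three, FrdI Def. 1.2 (ii), 1.3 (i)(c)).
[cite: MochizukiFrdI2008, Def. 1.3(i)] -/
theorem pullbackSliceToBase_full (A : C) : (pullbackSliceToBase F A).Full := by
  refine ⟨fun {Y Y'} d => ?_⟩
  have hd : d.left ≫ Base F Y'.hom.1 = Base F Y.hom.1 := Over.w d
  obtain ⟨γ, hγ⟩ := (Y'.hom.2 Y.left.obj).2 ⟨(Y.hom.1, d.left), hd.symm⟩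
  have hγ1 : γ ≫ Y'.hom.1 = Y.hom.1 :=
    congrArg (fun p : PullbackHomData F Y'.hom.1 Y.left.obj => p.1.1) hγ
  have hγ2 : Base F γ = d.left :=
    congrArg (fun p : PullbackHomData F Y'.hom.1 Y.left.obj => p.1.2) hγ
  have hγpb : IsPullbackMorphism F γ := by
    refine IsPullbackMorphism.of_comp F Y'.hom.2 ?_
    rw [hγ1]
    exact Y.hom.2
  exact ⟨Over.homMk ⟨γ, hγpb⟩ (InducedWideCategory.Hom.ext hγ1), Over.OverMorphism.ext hγ2⟩

end PreFrobenioid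

namespace ElemFrobenioid

variable {D : Type u} [Category.{v} D] {Φ : Dᵒᵖ ⥤ CommMonCat.{w}}

variable (Φ) in
/-- Pull-back along an isomorphism `f : B ⥲ A` of `D` as a multiplicative equivalence
`Φ(A) ≃ Φ(B)`. [cite: MochizukiFrdI2008, Def. 1.1(ii)] -/
noncomputable def pullEquiv {A B : D} (f : B ⟶ A) [IsIso f] : Φ.obj (op A) ≃* Φ.obj (op B) :=
  MonoidHom.toMulEquiv (pull Φ f) (pull Φ (inv f))
    (by
      ext x
      show pull Φ (inv f) (pull Φ f x) = x
      rw [← pull_comp, IsIso.inv_hom_id, pull_id])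
    (by
      ext x
      show pull Φ f (pull Φ (inv f) x) = x
      rw [← pull_comp, IsIso.hom_inv_id, pull_id])

end ElemFrobenioid

end Literature.AlgebraicGeometry.Frobenioids
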